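import Summits.QuantumFields.BalabanUV.T4Continuum.Support.NE7CommutingConstraintHessian
import Summits.QuantumFields.BalabanUV.T4Continuum.Support.NE7CommutingHessForm
import Summits.QuantumFields.BalabanUV.T4Continuum.Support.NE7MinActHessianHessForm
import Summits.QuantumFields.BalabanUV.T4Continuum.Support.NE7MinActHessianFlatCurl
import HarnessLib

/-!
# NE7AbelianEffectiveFormCurved — THE CURVED EFFECTIVE QUADRATIC FORM IN THE U(1) SECTOR IS THE FLAT ONE UP TO THE FACTOR `1 ± a`, `a = ε·L^{−2(j+1)} ≤ ε`:
# `(1 − a)·D²(minAct_{j+1}∘chart_1)(0)[v,v] ≤ D²(minAct_{j+1}∘chart_{V₀})(0)[v,v] ≤ (1 + a)·D²(minAct_{j+1}∘chart_1)(0)[v,v]` at every small datum `V₀` whose minimiser has small multi-level loops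

Lineage `b2b-balaban-t4-ne7-p1` (CRUX PROVER NE7 #1 = OWNER of BINDER row NE7), generation 116 — brick 5 (assembly) of ROAD-G116 §7 (G-ab).  INPUTS BY NAME: the road's bordered Hessian at
every small datum ✓ `NE7MinActHessianHessForm.minAct_hessian_hessForm_allData` (`D²m_{V₀}(0)[v,v] = min{w·hess U♯ X̃ X̃ W − Dm(0)[D²𝒢(0)[X,X]] : levelQ′ U♯ X = v}`), the flat closed form
✓ `NE7MinActHessianFlatCurl.minAct_hessian_flat_curl` (`D²m_1(0)[v,v] = min{w·Σ_p nhsNormSq(curl_1 X̃ p) : levelQ′ 1 X = v}`), and the commuting-sector bricks of this generation: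
✓ `NE7CommutingHessForm.hess_ge_of_commute` ∕ `hess_le_of_commute` (`(1 ∓ a)`-comparison of `hess` with the flat Maxwell form, `a` = fine plaquette radius = `ε·L^{−2(j+1)}` for a class minimiser),
✓ `NE7CommutingPushForward.levelQ'_comm_eq_flat` (`levelQ′ U♯ = levelQ′ 1`: SAME constraint set), ✓ `NE7CommutingConstraintHessian.fderiv_fderiv_levelQ_chart_apply_eq_zero` (the multiplier
term VANISHES).  CONCLUSION **`abelian_effectiveForm_curved_two_sided`** (`d = 4`, commuting colour algebra `hcomm` — e.g. `[Unique n]`, `U(1)` —, `L ≥ 2`): `∃ ε₀ > 0, ∀ 0 < ε ≤ ε₀, ∀ N ≥ 1,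
∀ j, ∃ δ_V > 0` such that for every unitary `N`-periodic `δ_V`-small datum `V₀`, every minimiser `U♯` over it WHOSE ITERATED AVERAGES `cavgIter L m U♯`, `m ≤ j`, HAVE LOOP RADIUS `≤ 1/4`
(an explicit binder — for `U(1)` data it follows from the class radius by the abelian radius propagation `a ↦ ≈L²a`, NOT done here), and every `v`:
  `(1 − ε/(L^{j+1})²)·D²m_1(0)[v,v] ≤ D²m_{V₀}(0)[v,v] ≤ (1 + ε/(L^{j+1})²)·D²m_1(0)[v,v]`
— with the road's ✓ `NE7EffectiveFormCoarseCurlAllLevels` and row NE7b's ✓ `NE7EffectiveFormCurlEquivalence` this pins the CURVED abelian effective form between `(1−ε)·` and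
`(1+ε)·homC 4·` the coarse Maxwell form, constants uniform in `j`, `N` (the radius `δ_V(j)` is the road's level-dependent one).  [folklore]; 0 def, 0 sorry.
HONEST FRAMING: U(1)∕commuting sector only; OUR minimisers (B11 (8) with `sfClass`); ∀ j ∃ δ_V; the multi-level loop smallness of the minimiser is ASSUMED; nothing of Bałaban's
asserted; NOT NE7 as a spine node; spine 0∕9; NOT infinite volume, NOT mass gap, NOT BetaPertH, NOT Clay.
-/

set_option autoImplicit false

open scoped BigOperators Matrix Matrix.Norms.L2Operator Topology
open NormedSpace Finset Set Filter Metric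

namespace Summit.QuantumFields.BalabanUV.T4Continuum.NE7AbelianEffectiveFormCurved

open Literature.MathematicalPhysics.QuantumFieldTheory.Balaban1983to89
open B7Prop1Explicit B7Prop2Explicit
open T4AveragingDeficitWall (IsUnitaryCfg SmallField curl)
open T4AveragingDeficitWallBoundary (IsPeriodicCfg)
open AveragingDeficitTorusChart (TDir chart chartDir)
open AveragingDeficitChartCalculus (cavg)
open AveragingDeficitTwoLevelPrep (skewSub)
open AveragingDeficitMultiLevelPrep (tower levelQ levelQ' cavgIter tower_ne_zero)
open MinimalActionLevels (perWin stepWt stepWt_pos)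
open MinimalActionSandwich (IsMinimiser minAct admissible)
open MinimalActionRate (sfClass)
open MinimalActionWitness (flatCfg)
open MatrixNorms (nhsNormSq nhsNormSq_nonneg)
open NE3HessForm (hess)
open NE7MinActHessianHessForm (minAct_hessian_hessForm_allData)
open NE7MinActHessianFlatCurl (minAct_hessian_flat_curl)
open NE7FlatAverageCurlCommutation (isSkewDir_chartDir_id)
open NE7CommutingHessForm (hess_ge_of_commute hess_le_of_commute)
open NE7CommutingPushForward (levelQ'_comm_eq_flat)
open NE7CommutingConstraintHessian (fderiv_fderiv_levelQ_chart_apply_eq_zero)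

noncomputable section

variable {n : Type} [Fintype n] [DecidableEq n]

/-- `cavgIter L m = (cavg L)^[m]`. [folklore] -/
theorem cavgIter_eq_iterate {d : ℕ} (L : ℕ) : ∀ (m : ℕ) (W : Site d → Fin d → (Matrix n n ℂ)ˣ), cavgIter L m W = (cavg L)^[m] W
  | 0, _ => rfl
  | m + 1, W => by
      rw [Function.iterate_succ_apply]
      exact cavgIter_eq_iterate L m (cavg L W)

/-- **THE CURVED EFFECTIVE QUADRATIC FORM IN THE U(1) SECTOR IS THE FLAT ONE UP TO `1 ± ε·L^{−2(j+1)}`** (see the module docstring). [folklore] -/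
theorem abelian_effectiveForm_curved_two_sided [Nonempty n] (hcomm : ∀ a b : Matrix n n ℂ, Commute a b) {L : ℕ} [NeZero L] (hL : 2 ≤ L) :
    ∃ ε₀ : ℝ, 0 < ε₀ ∧ ∀ ε : ℝ, 0 < ε → ε ≤ ε₀ → ∀ (N : ℕ) [NeZero N], 1 ≤ N → ∀ j : ℕ,
      ∃ δV : ℝ, 0 < δV ∧
        ∀ V₀ ∈ {V : Site 4 → Fin 4 → (Matrix n n ℂ)ˣ | IsUnitaryCfg V ∧ IsPeriodicCfg V (N : ℤ) ∧ SmallField V δV},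
        ∀ Us : Site 4 → Fin 4 → (Matrix n n ℂ)ˣ, IsMinimiser 4 (sfClass 4 L N ε) L N (j + 1) V₀ Us →
          (∀ m ≤ j, ∀ (q : Site 4) (κ : Fin 4) (r : Fin 4 → Fin L),
              ‖((Wcx L (cavgIter L m Us) q κ (boxVec L r) : (Matrix n n ℂ)ˣ) : Matrix n n ℂ) - 1‖ ≤ 1 / 4) →
          ∀ v : ↥(skewSub 4 n N),
            (1 - ε / ((L : ℝ) ^ (j + 1)) ^ 2) *
                fderiv ℝ (fderiv ℝ (fun y : ↥(skewSub 4 n N) => minAct 4 (sfClass 4 L N ε) L N (j + 1)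
                  (chart (ContinuousLinearMap.id ℝ (Matrix n n ℂ)) N (flatCfg : Site 4 → Fin 4 → (Matrix n n ℂ)ˣ) (y : TDir 4 n N)))) 0 v v
              ≤ fderiv ℝ (fderiv ℝ (fun y : ↥(skewSub 4 n N) => minAct 4 (sfClass 4 L N ε) L N (j + 1)
                  (chart (ContinuousLinearMap.id ℝ (Matrix n n ℂ)) N V₀ (y : TDir 4 n N)))) 0 v v ∧
            fderiv ℝ (fderiv ℝ (fun y : ↥(skewSub 4 n N) => minAct 4 (sfClass 4 L N ε) L N (j + 1)
                  (chart (ContinuousLinearMap.id ℝ (Matrix n n ℂ)) N V₀ (y : TDir 4 n N)))) 0 v v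
              ≤ (1 + ε / ((L : ℝ) ^ (j + 1)) ^ 2) *
                fderiv ℝ (fderiv ℝ (fun y : ↥(skewSub 4 n N) => minAct 4 (sfClass 4 L N ε) L N (j + 1)
                  (chart (ContinuousLinearMap.id ℝ (Matrix n n ℂ)) N (flatCfg : Site 4 → Fin 4 → (Matrix n n ℂ)ˣ) (y : TDir 4 n N)))) 0 v v := by
  have hL1 : 1 ≤ L := by omega
  obtain ⟨ε₁, hε₁, H₁⟩ := minAct_hessian_hessForm_allData (n := n) hL
  obtain ⟨ε₂, hε₂, H₂⟩ := minAct_hessian_flat_curl (n := n) hL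
  refine ⟨min (min ε₁ ε₂) 1, lt_min (lt_min hε₁ hε₂) one_pos, fun ε hε hεle N _ hN j => ?_⟩
  have hε1 : ε ≤ ε₁ := hεle.trans ((min_le_left _ _).trans (min_le_left _ _))
  have hε2 : ε ≤ ε₂ := hεle.trans ((min_le_left _ _).trans (min_le_right _ _))
  have hεone : ε ≤ 1 := hεle.trans (min_le_right _ _)
  obtain ⟨δV, hδV, Hcur⟩ := H₁ ε hε hε1 N hN j
  obtain ⟨-, hflat⟩ := H₂ ε hε hε2 N hN j
  refine ⟨δV, hδV, fun V₀ hV₀ Us hUs hloops v => ?_⟩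
  haveI : NeZero (L * tower L N j) := ⟨Nat.mul_ne_zero (NeZero.ne L) (tower_ne_zero L N j)⟩
  obtain ⟨-, hall⟩ := Hcur V₀ hV₀
  obtain ⟨-, hcur⟩ := hall Us hUs
  -- the class data of the minimiser
  have hmem : Us ∈ sfClass 4 L N ε (j + 1) := hUs.mem.1
  obtain ⟨hUu, -, hUsf⟩ := hmem
  set a : ℝ := ε / ((L : ℝ) ^ (j + 1)) ^ 2 with ha
  have hLpos : (0 : ℝ) < ((L : ℝ) ^ (j + 1)) ^ 2 := by positivity
  have ha0 : 0 ≤ a := div_nonneg hε.le hLpos.le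
  have ha1 : a ≤ 1 := by
    rw [ha, div_le_one hLpos]
    have : (1 : ℝ) ≤ ((L : ℝ) ^ (j + 1)) ^ 2 := one_le_pow₀ (one_le_pow₀ (by exact_mod_cast hL1))
    linarith
  have hplaq : ∀ p ∈ perWin 4 (N * L ^ (j + 1)),
      ‖((hol Us p.1 (plaqWord p.2.1.1 p.2.1.2) : (Matrix n n ℂ)ˣ) : Matrix n n ℂ) - 1‖ ≤ a :=
    fun p _ => hUsf p.1 p.2.1.1 p.2.1.2 (ne_of_lt p.2.2)
  -- the bricks
  have hW' : ∀ i ≤ j, ∀ (q : Site 4) (κ : Fin 4) (r : Fin 4 → Fin L),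
      ‖((Wcx L ((cavg L)^[i] Us) q κ (boxVec L r) : (Matrix n n ℂ)ˣ) : Matrix n n ℂ) - 1‖ ≤ 1 / 4 := fun i hi q κ r => by
    rw [← cavgIter_eq_iterate]; exact hloops i hi q κ r
  have hQ : levelQ' L N j Us = levelQ' L N j (flatCfg : Site 4 → Fin 4 → (Matrix n n ℂ)ˣ) := levelQ'_comm_eq_flat hcomm j Us hW'
  have hG : ∀ X : ↥(skewSub 4 n (L * tower L N j)),
      fderiv ℝ (fderiv ℝ (fun Φ : ↥(skewSub 4 n (L * tower L N j)) =>
        levelQ L N j Us (chart (ContinuousLinearMap.id ℝ (Matrix n n ℂ)) (L * tower L N j) Us (Φ : TDir 4 n (L * tower L N j))))) 0 X X = 0 :=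
    fun X => fderiv_fderiv_levelQ_chart_apply_eq_zero hcomm hL1 j Us (fun m hm y κ r => hloops m hm _ κ r) X
  have hH : ∀ X : ↥(skewSub 4 n (L * tower L N j)),
      (1 - a) * ∑ p ∈ perWin 4 (N * L ^ (j + 1)), nhsNormSq (curl (flatCfg : Site 4 → Fin 4 → (Matrix n n ℂ)ˣ)
          (chartDir (ContinuousLinearMap.id ℝ (Matrix n n ℂ)) (L * tower L N j) (X : TDir 4 n (L * tower L N j))) p)
        ≤ hess Us (chartDir (ContinuousLinearMap.id ℝ (Matrix n n ℂ)) (L * tower L N j) (X : TDir 4 n (L * tower L N j)))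
            (chartDir (ContinuousLinearMap.id ℝ (Matrix n n ℂ)) (L * tower L N j) (X : TDir 4 n (L * tower L N j))) (perWin 4 (N * L ^ (j + 1))) ∧
      hess Us (chartDir (ContinuousLinearMap.id ℝ (Matrix n n ℂ)) (L * tower L N j) (X : TDir 4 n (L * tower L N j)))
            (chartDir (ContinuousLinearMap.id ℝ (Matrix n n ℂ)) (L * tower L N j) (X : TDir 4 n (L * tower L N j))) (perWin 4 (N * L ^ (j + 1)))
        ≤ (1 + a) * ∑ p ∈ perWin 4 (N * L ^ (j + 1)), nhsNormSq (curl (flatCfg : Site 4 → Fin 4 → (Matrix n n ℂ)ˣ)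
          (chartDir (ContinuousLinearMap.id ℝ (Matrix n n ℂ)) (L * tower L N j) (X : TDir 4 n (L * tower L N j))) p) :=
    fun X => ⟨hess_ge_of_commute (fun _ _ _ _ => hcomm _ _) (fun _ _ _ _ => hcomm _ _) (isSkewDir_chartDir_id X.2) _ hplaq,
      hess_le_of_commute (fun _ _ _ _ => hcomm _ _) (fun _ _ _ _ => hcomm _ _) (isSkewDir_chartDir_id X.2) _ hplaq⟩
  -- the two least-element characterisations
  have hc := hcur v
  have hf := hflat v
  set w : ℝ := ((stepWt 4 L)⁻¹) ^ (j + 1) with hw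
  have hw0 : 0 < w := pow_pos (inv_pos.mpr (stepWt_pos (d := 4) L hL1)) _
  -- lower bound: the curved minimum is attained at some `X₂`
  obtain ⟨X₂, hX₂, hval₂⟩ := hc.1
  rw [hG X₂, map_zero, sub_zero] at hval₂
  have hX₂' : levelQ' L N j (flatCfg : Site 4 → Fin 4 → (Matrix n n ℂ)ˣ) (X₂ : TDir 4 n (L * tower L N j)) = v := by rw [← hQ]; exact hX₂
  have hlow₁ := hf.2 ⟨X₂, hX₂', rfl⟩
  -- upper bound: the flat minimum is attained at some `X₁`
  obtain ⟨X₁, hX₁, hval₁⟩ := hf.1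
  have hX₁' : levelQ' L N j Us (X₁ : TDir 4 n (L * tower L N j)) = v := by rw [hQ]; exact hX₁
  have hup₁ := hc.2 ⟨X₁, hX₁', by rw [hG X₁, map_zero, sub_zero]⟩
  constructor
  · rw [hval₂]
    have h1 := (hH X₂).1
    have h2 : (1 - a) * (w * ∑ p ∈ perWin 4 (N * L ^ (j + 1)), nhsNormSq (curl (flatCfg : Site 4 → Fin 4 → (Matrix n n ℂ)ˣ)
        (chartDir (ContinuousLinearMap.id ℝ (Matrix n n ℂ)) (L * tower L N j) (X₂ : TDir 4 n (L * tower L N j))) p))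
        ≤ w * hess Us (chartDir (ContinuousLinearMap.id ℝ (Matrix n n ℂ)) (L * tower L N j) (X₂ : TDir 4 n (L * tower L N j)))
            (chartDir (ContinuousLinearMap.id ℝ (Matrix n n ℂ)) (L * tower L N j) (X₂ : TDir 4 n (L * tower L N j))) (perWin 4 (N * L ^ (j + 1))) := by
      nlinarith [h1, hw0]
    exact (mul_le_mul_of_nonneg_left hlow₁ (by linarith)).trans h2
  · refine hup₁.trans ?_
    rw [hval₁]
    have h1 := (hH X₁).2
    nlinarith [h1, hw0]

end

end Summit.QuantumFields.BalabanUV.T4Continuum.NE7AbelianEffectiveFormCurved
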